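import Literature.GroupTheory.CombinatorialGroupTheory.RibbonGraphGeometricBasis
import Mathlib.Logic.Equiv.Fin.Basic
import HarnessLib

/-!
# Geometric free bases of one-vertex ribbon graphs: the MERGE step

Topic `Literature/GroupTheory/CombinatorialGroupTheory`; continues
`RibbonGraphGeometricBasis.lean`.  Let `e` be an edge of the one-vertex ribbon graph `(E, ρ)` whose
two darts `h`, `h̄` lie on DIFFERENT boundary cycles (words `e · U`, `e⁻¹ · V`), so that deleting
`e` MERGES them into one boundary cycle (word `U · V`, `RibbonGraphEdgeDeletionCycles.lean`).
From a geometric basis of the smaller ribbon graph `(E ∖ {e}, delRot ρ e)` in which the merged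
cycle is the LAST one (arrange by `GeometricBasis.rotate`) we build a geometric basis of `(E, ρ)`
with the same handles and ONE MORE boundary generator `X := τ · (e · U) · τ⁻¹` — a Nielsen move on
the fresh letter `e` (`mulGenAut`), where `U · V = τ⁻¹ · L · τ` expresses the merged word through
the last boundary word `L` of the given basis (`GeometricBasis.mergeStep`).  Genus unchanged,
`m ↦ m + 1`; with `|E ∖ {e}| + 1 = |E|` this keeps `2g + m = |E|`.
-/

namespace Literature.GroupTheory.CombinatorialGroupTheory

namespace RibbonGraph

open Equiv Equiv.Perm Function

universe u

/-! ### The index bijection `GBIndex g (m+1) ≃ GBIndex g m ⊕ Unit` -/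

/-- Splitting off the last boundary index. [cite: ZieschangVogtColdewey1980, Prop. 3.2.4 (canonical normal form 3.2.6)] -/
def gbIndexSucc (g m : ℕ) : GBIndex g (m + 1) ≃ GBIndex g m ⊕ Unit :=
  (Equiv.sumCongr (Equiv.refl (Fin g × Bool))
    (finSuccEquivLast.trans (Equiv.optionEquivSumPUnit (Fin m)))).trans (Equiv.sumAssoc _ _ _).symm

/-- `gbIndexSucc_inl`: bookkeeping lemma of this construction (see the module docstring). [cite: ZieschangVogtColdewey1980, Prop. 3.2.4 (canonical normal form 3.2.6)] -/
@[simp] theorem gbIndexSucc_inl (g m : ℕ) (ib : Fin g × Bool) :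
    gbIndexSucc g m (Sum.inl ib) = Sum.inl (Sum.inl ib) := rfl

/-- `gbIndexSucc_inr_castSucc`: bookkeeping lemma of this construction (see the module docstring). [cite: ZieschangVogtColdewey1980, Prop. 3.2.4 (canonical normal form 3.2.6)] -/
@[simp] theorem gbIndexSucc_inr_castSucc (g m : ℕ) (k : Fin m) :
    gbIndexSucc g m (Sum.inr k.castSucc) = Sum.inl (Sum.inr k) := by
  simp [gbIndexSucc]

/-- `gbIndexSucc_inr_last`: bookkeeping lemma of this construction (see the module docstring). [cite: ZieschangVogtColdewey1980, Prop. 3.2.4 (canonical normal form 3.2.6)] -/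
@[simp] theorem gbIndexSucc_inr_last (g m : ℕ) :
    gbIndexSucc g m (Sum.inr (Fin.last m)) = Sum.inr () := by
  simp [gbIndexSucc]

/-- `map_gbIndexSucc_handleWord`: bookkeeping lemma of this construction (see the module docstring). [cite: ZieschangVogtColdewey1980, Prop. 3.2.4 (canonical normal form 3.2.6)] -/
theorem map_gbIndexSucc_handleWord (g m : ℕ) :
    FreeGroup.map (gbIndexSucc g m) (handleWord g (m + 1)) = FreeGroup.map Sum.inl (handleWord g m) := by
  have hfun : ((FreeGroup.map (gbIndexSucc g m)) ∘ fun i : Fin g =>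
      FreeGroup.of (Sum.inl (i, true) : GBIndex g (m + 1)) * FreeGroup.of (Sum.inl (i, false) : GBIndex g (m + 1)) *
        (FreeGroup.of (Sum.inl (i, true) : GBIndex g (m + 1)))⁻¹ *
          (FreeGroup.of (Sum.inl (i, false) : GBIndex g (m + 1)))⁻¹) =
      ((FreeGroup.map Sum.inl) ∘ fun i : Fin g =>
      FreeGroup.of (Sum.inl (i, true) : GBIndex g m) * FreeGroup.of (Sum.inl (i, false) : GBIndex g m) *
        (FreeGroup.of (Sum.inl (i, true) : GBIndex g m))⁻¹ *
          (FreeGroup.of (Sum.inl (i, false) : GBIndex g m))⁻¹) := by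
    funext i; simp
  simp only [handleWord, map_list_prod, List.map_ofFn, hfun]

variable {E : Type u} [Finite E] [DecidableEq E] {ρ : Perm (Dart E)} {e : E} {g m p q : ℕ}

/-! ### The merge step -/

section Merge

variable (hne : ¬ (face ρ).SameCycle (e, true) (e, false))
  (hp : minimalPeriod (face ρ) (e, true) = p + 1) (hq : minimalPeriod (face ρ) (e, false) = q + 1)
  (hpq : 0 < p + q) (G : GeometricBasis (delRot ρ e) g m)
  (hlast : (delFace ρ e).SameCycle (dartEmb e (G.rep (Fin.last m))) (mergeSeq ρ e p 0))

/-- The inclusion `F(E ∖ {e}) → F(E)`. [cite: ZieschangVogtColdewey1980, Prop. 3.2.4 (canonical normal form 3.2.6)] -/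
abbrev ιE (e : E) : FreeGroup {x : E // x ≠ e} →* FreeGroup E := FreeGroup.map Subtype.val

include hne hp hq hpq hlast in
/-- The merged word `U · V`, read in the smaller ribbon graph at the last representative, is a
conjugate of the inverse surface word of the given basis: the data `(τ', U')` with
`U = ι U'`, `U · V = (ι τ')⁻¹ · (ι β'(sw))⁻¹ · (ι τ')`. [cite: ZieschangVogtColdewey1980, Prop. 3.2.4 (canonical normal form 3.2.6)] -/
theorem merge_exists_words :
    ∃ (τ' U' : FreeGroup {x : E // x ≠ e}),
      ιE e U' = prodFrom (face ρ) letter (face ρ (e, true)) p ∧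
      prodFrom (face ρ) letter (face ρ (e, true)) p * prodFrom (face ρ) letter (face ρ (e, false)) q =
        (ιE e τ')⁻¹ * (ιE e (G.β (surfaceWord g m)))⁻¹ * ιE e τ' := by
  obtain ⟨z₀, hz₀⟩ := exists_dartEmb_eq e (d := mergeSeq ρ e p 0) (mergeSeq_zero_fst_ne hne hp hq hpq)
  have hcyc : (face (delRot ρ e)).SameCycle (G.rep (Fin.last m)) z₀ := by
    rw [sameCycle_face_delRot_iff, hz₀]; exact hlast
  obtain ⟨c, hc⟩ := exists_cycleProd_eq_conj_of_sameCycle (face (delRot ρ e)) letter hcyc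
  refine ⟨G.t (Fin.last m) * c, prodFrom (face (delRot ρ e)) letter z₀ p, ?_, ?_⟩
  · rw [prodFrom_map_of_semiconj (face (delRot ρ e)) (delFace ρ e) (dartEmb e) (dartEmb_face_delRot ρ e)
      letter letter (FreeGroup.map Subtype.val) (letter_dartEmb e) z₀ p, hz₀, merge_prodFrom_fst hne hp hq]
  · have h1 : ιE e (cycleProd (face (delRot ρ e)) letter z₀) =
        prodFrom (face ρ) letter (face ρ (e, true)) p * prodFrom (face ρ) letter (face ρ (e, false)) q := by
      rw [map_cycleProd_face_delRot, hz₀, cycleProd, merge_minimalPeriod hne hp hq hpq,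
        merge_prodFrom hne hp hq]
    have h2 : cycleProd (face (delRot ρ e)) letter (G.rep (Fin.last m)) =
        (G.t (Fin.last m))⁻¹ * (G.β (surfaceWord g m))⁻¹ * G.t (Fin.last m) := by
      rw [← G.last_eq]; group
    rw [← h1, hc, h2]
    simp only [map_mul, map_inv]
    group

omit [Finite E] in
/-- `optionNeEquiv_comp_inl`: bookkeeping lemma of this construction (see the module docstring). [cite: ZieschangVogtColdewey1980, Prop. 3.2.4 (canonical normal form 3.2.6)] -/
theorem optionNeEquiv_comp_inl : (⇑(optionNeEquiv e) ∘ Sum.inl) = (Subtype.val : {x : E // x ≠ e} → E) :=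
  rfl

/-- The change of basis of the merge step on `F((E ∖ {e}) ⊔ ⋆)`: the fresh letter
`⋆ ↦ τ' U' ⋆ τ'⁻¹`. [cite: ZieschangVogtColdewey1980, Prop. 3.2.4 (canonical normal form 3.2.6)] -/
noncomputable def mergeAut (τ' U' : FreeGroup {x : E // x ≠ e}) :
    MulAut (FreeGroup ({x : E // x ≠ e} ⊕ Unit)) :=
  mulGenAut (Sum.inr ()) (FreeGroup.map Sum.inl (τ' * U')) (FreeGroup.map Sum.inl τ'⁻¹)
    (map_inl_mem_genAvoiding _ _) (map_inl_mem_genAvoiding _ _)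

/-- The new free basis of the merge step. [cite: ZieschangVogtColdewey1980, Prop. 3.2.4 (canonical normal form 3.2.6)] -/
noncomputable def mergeBasis (G : GeometricBasis (delRot ρ e) g m) (τ' U' : FreeGroup {x : E // x ≠ e}) :
    FreeGroup (GBIndex g (m + 1)) ≃* FreeGroup E :=
  (FreeGroup.freeGroupCongr (gbIndexSucc g m)).trans
    ((sumCongrLeft G.β).trans ((mergeAut τ' U').trans (FreeGroup.freeGroupCongr (optionNeEquiv e))))

/-- `mergeBasis_map_inl`: bookkeeping lemma of this construction (see the module docstring). [cite: ZieschangVogtColdewey1980, Prop. 3.2.4 (canonical normal form 3.2.6)] -/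
theorem mergeBasis_map_inl (τ' U' : FreeGroup {x : E // x ≠ e}) (x : FreeGroup (GBIndex g m)) :
    ((sumCongrLeft G.β).trans ((mergeAut (e := e) τ' U').trans
      (FreeGroup.freeGroupCongr (optionNeEquiv e)))) (FreeGroup.map Sum.inl x) = ιE e (G.β x) := by
  rw [MulEquiv.trans_apply, MulEquiv.trans_apply, sumCongrLeft_map_inl]
  exact freeGroupCongr_optionNeEquiv_map_inl_of_fix e _
    (fun y hy => mulGenAut_eq_self_of_mem _ _ _ _ hy) _

/-- `mergeBasis_of_inl`: bookkeeping lemma of this construction (see the module docstring). [cite: ZieschangVogtColdewey1980, Prop. 3.2.4 (canonical normal form 3.2.6)] -/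
@[simp] theorem mergeBasis_of_inl (τ' U' : FreeGroup {x : E // x ≠ e}) (ib : Fin g × Bool) :
    mergeBasis G τ' U' (FreeGroup.of (Sum.inl ib)) = ιE e (G.β (FreeGroup.of (Sum.inl ib))) := by
  rw [mergeBasis, MulEquiv.trans_apply, FreeGroup.freeGroupCongr_apply, FreeGroup.map.of,
    gbIndexSucc_inl, ← FreeGroup.map.of, mergeBasis_map_inl]

/-- `mergeBasis_of_inr_castSucc`: bookkeeping lemma of this construction (see the module docstring). [cite: ZieschangVogtColdewey1980, Prop. 3.2.4 (canonical normal form 3.2.6)] -/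
@[simp] theorem mergeBasis_of_inr_castSucc (τ' U' : FreeGroup {x : E // x ≠ e}) (k : Fin m) :
    mergeBasis G τ' U' (FreeGroup.of (Sum.inr k.castSucc)) = ιE e (G.β (FreeGroup.of (Sum.inr k))) := by
  rw [mergeBasis, MulEquiv.trans_apply, FreeGroup.freeGroupCongr_apply, FreeGroup.map.of,
    gbIndexSucc_inr_castSucc, ← FreeGroup.map.of, mergeBasis_map_inl]

/-- `mergeBasis_of_inr_last`: bookkeeping lemma of this construction (see the module docstring). [cite: ZieschangVogtColdewey1980, Prop. 3.2.4 (canonical normal form 3.2.6)] -/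
@[simp] theorem mergeBasis_of_inr_last (τ' U' : FreeGroup {x : E // x ≠ e}) :
    mergeBasis G τ' U' (FreeGroup.of (Sum.inr (Fin.last m))) =
      ιE e τ' * ιE e U' * FreeGroup.of e * (ιE e τ')⁻¹ := by
  rw [mergeBasis, MulEquiv.trans_apply, FreeGroup.freeGroupCongr_apply, FreeGroup.map.of,
    gbIndexSucc_inr_last, MulEquiv.trans_apply, MulEquiv.trans_apply, sumCongrLeft_of_inr, mergeAut,
    mulGenAut_of_self, FreeGroup.freeGroupCongr_apply]
  simp only [map_mul, map_inv, FreeGroup.map.of, optionNeEquiv_inr, FreeGroup.map.comp,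
    optionNeEquiv_comp_inl]

/-- `mergeBasis_handleWord`: bookkeeping lemma of this construction (see the module docstring). [cite: ZieschangVogtColdewey1980, Prop. 3.2.4 (canonical normal form 3.2.6)] -/
theorem mergeBasis_handleWord (τ' U' : FreeGroup {x : E // x ≠ e}) :
    mergeBasis G τ' U' (handleWord g (m + 1)) = ιE e (G.β (handleWord g m)) := by
  rw [mergeBasis, MulEquiv.trans_apply, FreeGroup.freeGroupCongr_apply, map_gbIndexSucc_handleWord,
    mergeBasis_map_inl]

/-- `mergeBasis_boundaryWordInit`: bookkeeping lemma of this construction (see the module docstring). [cite: ZieschangVogtColdewey1980, Prop. 3.2.4 (canonical normal form 3.2.6)] -/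
theorem mergeBasis_boundaryWordInit (τ' U' : FreeGroup {x : E // x ≠ e}) :
    mergeBasis G τ' U' ((List.ofFn fun k : Fin m =>
        FreeGroup.of (Sum.inr k.castSucc : GBIndex g (m + 1))).prod) = ιE e (G.β (boundaryWord g m)) := by
  rw [map_list_prod, List.map_ofFn, boundaryWord, map_list_prod, map_list_prod, List.map_ofFn, List.map_ofFn]
  have hfun : (⇑(mergeBasis G τ' U') ∘ fun k : Fin m => FreeGroup.of (Sum.inr k.castSucc : GBIndex g (m + 1))) =
      (⇑(ιE e) ∘ ⇑G.β ∘ fun k : Fin m => FreeGroup.of (Sum.inr k : GBIndex g m)) := by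
    funext k; simp
  rw [hfun]

/-- `mergeBasis_surfaceWord`: bookkeeping lemma of this construction (see the module docstring). [cite: ZieschangVogtColdewey1980, Prop. 3.2.4 (canonical normal form 3.2.6)] -/
theorem mergeBasis_surfaceWord (τ' U' : FreeGroup {x : E // x ≠ e}) :
    mergeBasis G τ' U' (surfaceWord g (m + 1)) =
      ιE e (G.β (surfaceWord g m)) * (ιE e τ' * ιE e U' * FreeGroup.of e * (ιE e τ')⁻¹) := by
  rw [surfaceWord, boundaryWord_succ, ← mul_assoc, map_mul, map_mul, mergeBasis_handleWord,
    mergeBasis_boundaryWordInit, mergeBasis_of_inr_last, surfaceWord, map_mul, map_mul]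

include hne hp hq hpq hlast in
/-- A representative of an OLD free slot does not lie on the boundary cycle of `h`. [cite: ZieschangVogtColdewey1980, Prop. 3.2.4 (canonical normal form 3.2.6)] -/
theorem merge_not_sameCycle_true (k : Fin m) :
    ¬ (face ρ).SameCycle (e, true) (dartEmb e (G.rep k.castSucc)) := by
  intro hs
  have h1 : (delFace ρ e).SameCycle (mergeSeq ρ e p 0) (dartEmb e (G.rep k.castSucc)) :=
    (merge_sameCycle_iff hne hp hq hpq _).2 (Or.inl ⟨fun h => dartEmb_fst_ne e _ (by rw [h]), hs⟩)
  have h2 : (face (delRot ρ e)).SameCycle (G.rep (Fin.last m)) (G.rep k.castSucc) := by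
    rw [sameCycle_face_delRot_iff]; exact hlast.trans h1
  exact (Fin.castSucc_lt_last k).ne' (G.rep_inj _ _ h2)

include hne hp hq hpq hlast in
/-- … nor on that of `h̄`. [cite: ZieschangVogtColdewey1980, Prop. 3.2.4 (canonical normal form 3.2.6)] -/
theorem merge_not_sameCycle_false (k : Fin m) :
    ¬ (face ρ).SameCycle (e, false) (dartEmb e (G.rep k.castSucc)) := by
  intro hs
  have h1 : (delFace ρ e).SameCycle (mergeSeq ρ e p 0) (dartEmb e (G.rep k.castSucc)) :=
    (merge_sameCycle_iff hne hp hq hpq _).2 (Or.inr ⟨fun h => dartEmb_fst_ne e _ (by rw [h]), hs⟩)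
  have h2 : (face (delRot ρ e)).SameCycle (G.rep (Fin.last m)) (G.rep k.castSucc) := by
    rw [sameCycle_face_delRot_iff]; exact hlast.trans h1
  exact (Fin.castSucc_lt_last k).ne' (G.rep_inj _ _ h2)

include hne hp hq hpq hlast in
/-- Old free slots keep their darts, lengths and words. [cite: ZieschangVogtColdewey1980, Prop. 3.2.4 (canonical normal form 3.2.6)] -/
theorem merge_others (k : Fin m) :
    cycleProd (delFace ρ e) letter (dartEmb e (G.rep k.castSucc)) =
        cycleProd (face ρ) letter (dartEmb e (G.rep k.castSucc)) ∧
      ∀ z, (delFace ρ e).SameCycle (dartEmb e (G.rep k.castSucc)) z ↔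
        (face ρ).SameCycle (dartEmb e (G.rep k.castSucc)) z :=
  (others_eq (merge_not_sameCycle_true hne hp hq hpq G hlast k)
    (merge_not_sameCycle_false hne hp hq hpq G hlast k)).2

/-- **The merge step.** [cite: ZieschangVogtColdewey1980, Prop. 3.2.4 (canonical normal form 3.2.6)] -/
noncomputable def GeometricBasis.mergeStep : GeometricBasis ρ g (m + 1) :=
  let W := merge_exists_words hne hp hq hpq G hlast
  let τ' := W.choose
  let U' := W.choose_spec.choose
  have hU : ιE e U' = prodFrom (face ρ) letter (face ρ (e, true)) p := W.choose_spec.choose_spec.1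
  have hUV : prodFrom (face ρ) letter (face ρ (e, true)) p * prodFrom (face ρ) letter (face ρ (e, false)) q =
      (ιE e τ')⁻¹ * (ιE e (G.β (surfaceWord g m)))⁻¹ * ιE e τ' := W.choose_spec.choose_spec.2
  { β := mergeBasis G τ' U'
    rep := Fin.snoc (Fin.snoc (fun k : Fin m => dartEmb e (G.rep k.castSucc)) (e, true)) (e, false)
    t := Fin.snoc (Fin.snoc (fun k : Fin m => ιE e (G.t k.castSucc)) (ιE e τ' * (FreeGroup.of e)⁻¹)) (ιE e τ')
    rep_surj := by
      intro x
      by_cases hx : x.1 ≠ e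
      · obtain ⟨x', rfl⟩ := exists_dartEmb_eq e hx
        obtain ⟨k', hk'⟩ := G.rep_surj x'
        cases k' using Fin.lastCases with
        | last =>
          have h1 : (delFace ρ e).SameCycle (mergeSeq ρ e p 0) (dartEmb e x') :=
            hlast.symm.trans ((sameCycle_face_delRot_iff ρ e _ _).1 hk')
          rcases (merge_sameCycle_iff hne hp hq hpq _).1 h1 with ⟨-, h⟩ | ⟨-, h⟩
          · exact ⟨(Fin.last m).castSucc, by simpa using h⟩
          · exact ⟨Fin.last (m + 1), by simpa using h⟩
        | cast k =>
          refine ⟨k.castSucc.castSucc, ?_⟩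
          simp only [Fin.snoc_castSucc]
          exact ((merge_others hne hp hq hpq G hlast k).2 _).1 ((sameCycle_face_delRot_iff ρ e _ _).1 hk')
      · rw [not_ne_iff] at hx
        rcases x with ⟨x, b⟩
        simp only at hx; subst hx
        cases b
        · exact ⟨Fin.last (m + 1), by simp only [Fin.snoc_last]; exact SameCycle.rfl⟩
        · exact ⟨(Fin.last m).castSucc, by
            simp only [Fin.snoc_castSucc, Fin.snoc_last]; exact SameCycle.rfl⟩
    rep_inj := by
      -- each representative determines its slot
      have key : ∀ (k : Fin (m + 2)) (l : Fin (m + 2)),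
          (face ρ).SameCycle
            ((Fin.snoc (Fin.snoc (fun k : Fin m => dartEmb e (G.rep k.castSucc)) (e, true)) (e, false) :
              Fin (m + 2) → Dart E) k)
            ((Fin.snoc (Fin.snoc (fun k : Fin m => dartEmb e (G.rep k.castSucc)) (e, true)) (e, false) :
              Fin (m + 2) → Dart E) l) → (k : ℕ) ≤ l → k = l := by
        intro k l hkl hle
        cases k using Fin.lastCases with
        | last => exact Fin.le_antisymm (Fin.le_last l) hle |>.symm
        | cast k =>
          cases k using Fin.lastCases with
          | last =>
            cases l using Fin.lastCases with
            | last => simp at hkl; exact absurd hkl hne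
            | cast l =>
              cases l using Fin.lastCases with
              | last => rfl
              | cast l => exfalso; have := l.isLt; simp at hle; omega
          | cast k =>
            cases l using Fin.lastCases with
            | last =>
              simp at hkl
              exact absurd hkl.symm (merge_not_sameCycle_false hne hp hq hpq G hlast k)
            | cast l =>
              cases l using Fin.lastCases with
              | last =>
                simp at hkl
                exact absurd hkl.symm (merge_not_sameCycle_true hne hp hq hpq G hlast k)
              | cast l =>
                simp only [Fin.snoc_castSucc] at hkl
                have h1 := ((merge_others hne hp hq hpq G hlast k).2 _).2 hkl
                rw [← sameCycle_face_delRot_iff] at h1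
                have := G.rep_inj _ _ h1
                simp only [Fin.castSucc_inj] at this
                rw [this]
      intro k l hkl
      rcases le_total (k : ℕ) l with h | h
      · exact key k l hkl h
      · exact (key l k hkl.symm h).symm
    free_eq := by
      intro k
      cases k using Fin.lastCases with
      | last =>
        simp only [Fin.snoc_castSucc, Fin.snoc_last, mergeBasis_of_inr_last]
        rw [cycleProd_true_eq ρ e hp, ← hU]
        group
      | cast k =>
        simp only [Fin.snoc_castSucc, mergeBasis_of_inr_castSucc]
        rw [← (merge_others hne hp hq hpq G hlast k).1, ← map_cycleProd_face_delRot, ← G.free_eq k]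
        simp only [map_mul, map_inv]
    last_eq := by
      simp only [Fin.snoc_last, mergeBasis_surfaceWord]
      rw [cycleProd_false_eq ρ e hq]
      have hV : prodFrom (face ρ) letter (face ρ (e, false)) q =
          (ιE e U')⁻¹ * ((ιE e τ')⁻¹ * (ιE e (G.β (surfaceWord g m)))⁻¹ * ιE e τ') := by
        rw [← hUV, hU]; group
      rw [hV]
      group
    card_eq := by
      have h1 := G.card_eq
      have h2 : Nat.card {x : E // x ≠ e} + 1 = Nat.card E := by
        rw [← Nat.card_unique (α := Unit), ← Nat.card_sum]
        exact Nat.card_congr (optionNeEquiv e)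
      omega }

/-- The representatives of the merge step: old free slots first, then `h`, then `h̄` (last).
[cite: ZieschangVogtColdewey1980, Prop. 3.2.4 (canonical normal form 3.2.6)] -/
theorem GeometricBasis.mergeStep_rep :
    (GeometricBasis.mergeStep hne hp hq hpq G hlast).rep =
      Fin.snoc (Fin.snoc (fun k : Fin m => dartEmb e (G.rep k.castSucc)) (e, true)) (e, false) := rfl

end Merge

section SplitIndex

/-! ### The index bijection of the split step -/

/-- New indices ↦ old indices plus one fresh letter: the new handle pair `(last, true/false)`
goes to the old free slot `a` and to the fresh letter; the new free slot `k` to the old free slot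
`a.succAbove k`. [cite: ZieschangVogtColdewey1980, Prop. 3.2.4 (canonical normal form 3.2.6)] -/
def splitIndexEquiv (g m : ℕ) (a : Fin (m + 1)) : GBIndex (g + 1) m ≃ GBIndex g (m + 1) ⊕ Unit where
  toFun
    | Sum.inl (i, b) => Fin.lastCases (if b then Sum.inl (Sum.inr a) else Sum.inr ())
        (fun i' => Sum.inl (Sum.inl (i', b))) i
    | Sum.inr k => Sum.inl (Sum.inr (a.succAbove k))
  invFun
    | Sum.inl (Sum.inl (i, b)) => Sum.inl (i.castSucc, b)
    | Sum.inl (Sum.inr j) =>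
        match finSuccEquiv' a j with
        | none => Sum.inl (Fin.last g, true)
        | some k => Sum.inr k
    | Sum.inr _ => Sum.inl (Fin.last g, false)
  left_inv x := by
    rcases x with ⟨i, b⟩ | k
    · cases i using Fin.lastCases with
      | last => cases b <;> simp [finSuccEquiv'_at]
      | cast i => simp
    · simp [finSuccEquiv'_succAbove]
  right_inv y := by
    rcases y with (⟨i, b⟩ | j) | ⟨⟩
    · simp
    · rcases hj : finSuccEquiv' a j with _ | k
      · have : j = a := (finSuccEquiv' a).injective (by rw [hj, finSuccEquiv'_at])
        subst this; simp [hj]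
      · have : j = a.succAbove k := by
          rw [← finSuccEquiv'_symm_some a k, ← hj, Equiv.symm_apply_apply]
        subst this; simp [hj]
    · simp

variable {g m : ℕ} (a : Fin (m + 1))

/-- `splitIndexEquiv_inl_castSucc`: bookkeeping lemma of this construction (see the module docstring). [cite: ZieschangVogtColdewey1980, Prop. 3.2.4 (canonical normal form 3.2.6)] -/
@[simp] theorem splitIndexEquiv_inl_castSucc (i : Fin g) (b : Bool) :
    splitIndexEquiv g m a (Sum.inl (i.castSucc, b)) = Sum.inl (Sum.inl (i, b)) := by
  simp [splitIndexEquiv]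

/-- `splitIndexEquiv_inl_last_true`: bookkeeping lemma of this construction (see the module docstring). [cite: ZieschangVogtColdewey1980, Prop. 3.2.4 (canonical normal form 3.2.6)] -/
@[simp] theorem splitIndexEquiv_inl_last_true :
    splitIndexEquiv g m a (Sum.inl (Fin.last g, true)) = Sum.inl (Sum.inr a) := by
  simp [splitIndexEquiv]

/-- `splitIndexEquiv_inl_last_false`: bookkeeping lemma of this construction (see the module docstring). [cite: ZieschangVogtColdewey1980, Prop. 3.2.4 (canonical normal form 3.2.6)] -/
@[simp] theorem splitIndexEquiv_inl_last_false :
    splitIndexEquiv g m a (Sum.inl (Fin.last g, false)) = Sum.inr () := by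
  simp [splitIndexEquiv]

/-- `splitIndexEquiv_inr`: bookkeeping lemma of this construction (see the module docstring). [cite: ZieschangVogtColdewey1980, Prop. 3.2.4 (canonical normal form 3.2.6)] -/
@[simp] theorem splitIndexEquiv_inr (k : Fin m) :
    splitIndexEquiv g m a (Sum.inr k) = Sum.inl (Sum.inr (a.succAbove k)) := rfl

end SplitIndex

end RibbonGraph

end Literature.GroupTheory.CombinatorialGroupTheory
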